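import Summits.HodgeConjecture.HodgeConjecture.Theorems.F0P6aSpecOrgansTQuotQuotSheet
import HarnessLib

/-!
# `F0P6aSpecOrgansT` — ★ RE-HOME of `Lines/F0_P6a_SpecOrgansT.lean` (tree sha16 8dca47ee93439c08, 1023 l.), PART 4 of 4 — tree lines :909–:1023 (LAST part: plain stem = the module the `Lines/` shim and every consumer import)
See PART 1 `Theorems/F0P6aSpecOrgansTBlockT5.lean` for the full ★ re-home header and the original module docstring (verbatim there).  Same namespace (every
fully-qualified name unchanged); the scopes open at the cut are re-opened below with their `variable` ∕ `open` ∕ `set_option` ∕ `universe` lines replayed verbatim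
from the tree, in order; the code after the replay block is the tree bytes :909–:1023, untouched.  HC_CM is proved only modulo the 7 printed citations (2 remaining: hLiu418 = stmt-HodgeConjecture-24832, h413 = stmt-HodgeConjecture-24833) until rung 0 closes; a re-home is count-neutral.
-/

-- ── replay of the scopes open at tree line :909 (verbatim) ──
set_option autoImplicit false
set_option linter.dupNamespace false
noncomputable section
universe u
namespace Summit.HodgeConjecture.HodgeConjecture.Cruxes.HLiu418.F0P6aLineSpecialisation
section Block_Q
open CategoryTheory CategoryTheory.Limits NumberField IsDedekindDomain MulAction AlgebraicGeometry
open scoped Matrix Polynomial Pointwise MonoidalCategory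
open Literature.NumberTheory.GaloisRepresentations
open Literature.NumberTheory.Automorphic Literature.NumberTheory.Automorphic.UnitaryGroup
open Literature.AlgebraicGeometry.ShimuraVarieties.UnitaryCanonicalModel
open Literature.NumberTheory.Automorphic.Liu2021.AppendixC
open Literature.AlgebraicGeometry.Motives (AlgPoints IntegralModel SchemeOver thickening thickeningGalAction thickeningLift specOver)
open Literature.NumberTheory.DiophantineGeometry (geomResidueField specialFibreFunctor specResidueField)
open Literature.AlgebraicGeometry.RelativeSpec (ActionOver)
open Literature.AlgebraicGeometry.AbelianSchemes Literature.AlgebraicGeometry.AbelianSchemes.AbelianSchemeOver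
open Literature.AlgebraicGeometry.GroupSchemes.AffineGroupScheme (Alg quotIncl)
open Summit.HodgeConjecture.HodgeConjecture.Cruxes.HLiu418.F0P6aModuliDatumDefs
open Summit.HodgeConjecture.HodgeConjecture.Cruxes.HLiu418.F0P6aRGDAssembly
open Summit.HodgeConjecture.HodgeConjecture.Cruxes.HLiu418.F0P6aDatumOfInputs
open Summit.HodgeConjecture.HodgeConjecture.Cruxes.HLiu418.F0P6aQuotientFibreEngineInputs
open Summit.HodgeConjecture.HodgeConjecture.Cruxes.HLiu418.F0P6aStubFROBRoofMiddleDual (exists_roofMiddleDual₀)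
section QuotWDFold
open scoped MonObj CategoryTheory.Obj
variable {F : Type} [Field F] [NumberField F] [IsCMField F] {ι₁ : F →+* ℂ}
    {Jstar : Matrix (Fin 2) (Fin 2) F}
    {K₀ : C5.OpenCompactSubgroup ↥(finAdelic ↥(maximalRealSubfield F) F (IsCMField.complexConj F) 2 Jstar)}
    {S : RecordSystemGS F Jstar ι₁ K₀} {hU7ₛ : S.HeckeTranslateDefinedOver}
    {hJ : (Jstar.map (IsCMField.complexConj F))ᵀ = Jstar} {hJu : IsUnit Jstar}
    {Fi : Type} [Field Fi] [Algebra F Fi] {Kc : C5.SmallLevel K₀} {G : Type} [Group G]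
    {𝓜 : IntegralModel (𝓞 F) F ((thickening F Fi).obj (S.M.obj Kc))}
    {w : HeightOneSpectrum (𝓞 F)} {hw : (IsCMField.complexConj F) • w ≠ w} {h𝓨 : (𝓜.localise w).IsSmoothProper 1}
    {θ : ActionOver (𝓜.localise w).total.hom ((Fi ≃ₐ[F] Fi) × G)}
    {e : Fi →ₐ[F] AlgebraicClosure (w.adicCompletion F)}

set_option maxHeartbeats 400000 in
set_option backward.isDefEq.respectTransparency false in
/-- **(C6α) `red₀Of_quotΩ_eq_of_quotLegReduction₀` — REDUCED QUOTIENT DATA MAKE THE SPECIAL QUOTIENT WELL DEFINED ON `(red₀ y, spGeoOf y L)`** (the [WQ] `QuotWellDefLaw`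
text in its two-lift form, minus the roof reduction (ρ1𝒞); LA6-p01 (g2) statement 70de5998 :343 with `hunr′` dropped (derived), the cover package `(𝔠 hQ𝔠 h𝔠)` after `h𝔭`,
the rank letter (RKG) `hrkG` (∀ x̄) after `𝔡` and the rank row (RK) inside `hdat` (both = LA2-p04 (g2)'s (C6′) binder texts), `hpN` LAST).  HYPOTHESIS `hdat` = the conclusion of LA1-p01 (g3)'s (ρ1𝒞) `exists_quotLegReduction` ce67c20f VERBATIM for every `(y, L)` (rows (FLAT-SURJ)(ACT)(LVL)(SIM ∀-form)
(K2-gen)(KILL)(DOCK), the `𝒞`-letters OUTSIDE `∀ y L`).  PROOF (the FOLD): (1) (C6α-T) moves the `(y, L)`-datum to `x̄ := red₀ y′`, `H := spGeoOf I 𝔡 y′ L′` along `(h, hsp)`,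
so both reduced legs `ψ₁ : A_{x̄} → 𝒞_{red₀ (quotΩ y L)}`, `ψ₂ : A_{x̄} → 𝒞_{red₀ (quotΩ y′ L′)}` leave the LITERAL source `A_{x̄}` and read ONE dock ideal `H`; (2) (K2-gen) at
`𝔞 := 𝔭_w𝔭_{c•w}` (premisses: `L ⊆ A_y[𝔭_{c•w}](Ω̄)` = `L.2.2.1` + `𝔭_w𝔭_{c•w} ≤ 𝔭_{c•w}`, and the tautology) puts both kernels in `A_{x̄}[𝔭_w𝔭_{c•w}]`; (3) (C6′)
`comp_eq_one_iff_of_two_quotLegs` (LA2-p04 (g2): ★ (H2) two-block Weil duality on `A_{x̄}[𝔭_w𝔭_{c•w}]`, ★ (LAG-c) Lagrangian kernels, ★ `exists_interLayer`, same dock part)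
⟹ `Ker ψ₁ = Ker ψ₂` on all `T`-points; (4) W1 `exists_roofMiddleDual₀` at the two targets gives exact-twist pairs `(DB̄ᵢ, pinᵢ, λ_B̄ᵢ, hexᵢ)`, the (SIM) ∀-rows instantiate;
(5) (C3𝒞) `red₀Of_eq_of_common_source_serre` (LA2-p01 (g2)) concludes `red₀ (quotΩ y L) = red₀ (quotΩ y′ L′)`. [cite: Liu2021, Prop. D.8 (2) p. 135, p. 137]
[cite: MumfordAV1970, §23 Thm. 2 (p. 231); §7 Thm. 4 (p. 72)] [cite: SerreTate1968, §1 Lemma 2] [cite: RapoportSmithlingZhang2020Diagonal, §4.1 Thm. 4.1 p. 17] -/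
theorem red₀Of_quotΩ_eq_of_quotLegReduction₀ (I : RGDInputsAt F ι₁ Jstar K₀ S hU7ₛ hJ hJu Fi Kc G 𝓜 w hw h𝓨 θ e) [ExpChar (geomResidueField w) I.pChar]
    {m : ℕ} (E' : Matrix (Fin m) (Fin m) (𝓞 F)) (hE' : E' * E' = E') (P : Matrix (Fin m) (Fin 1) (𝓞 F)) (Q : Matrix (Fin 1) (Fin m) (𝓞 F))
    (hP : E' * P = P) (hQ : Q * E' = Q) (hQP : Q * P = Matrix.scalar (Fin 1) (I.pChar : 𝓞 F))
    (hPQ : P * Q = Matrix.scalar (Fin m) (I.pChar : 𝓞 F) * E') (h𝔭 : Ideal.span (Set.range fun k => P k 0) = w.asIdeal)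
    (𝔠 : Set (𝓞 F)) (hQ𝔠 : ∀ j k, Q j k ∈ 𝔠) (h𝔠 : ∀ a ∈ 𝔠, ∃ Pa : Matrix (Fin m) (Fin 1) (𝓞 F), E' * Pa = Pa ∧ Pa * Q = a • E')
    (𝔡 : ∀ xbar, DockAt I xbar)
    -- (RKG) the rank of `A_x̄[𝔭_w𝔭_{c•w}]`, BY VALUE for every closed realisation, at every special point (LA2-p04 (g2) (C6′) `hrkG` text under `∀ xbar`)
    (hrkG : ∀ (xbar : AlgPoints (𝓜.localise w).reductionAt (geomResidueField w))
      (G' : SchemeOver (geomResidueField w)) [GrpObj G'] [IsAffine G'.left] [Module.Finite (geomResidueField w) (Alg G')]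
      (j' : G' ⟶ (sch₀Of 𝓜 w I.univ xbar).X) [IsMonHom j'] [IsClosedImmersion j'.left],
      (∀ ⦃T : SchemeOver (geomResidueField w)⦄ (t : T ⟶ (sch₀Of 𝓜 w I.univ xbar).X),
        (∃ s : T ⟶ G', s ≫ j' = t) ↔ ∀ a ∈ w.asIdeal * ((IsCMField.complexConj F) • w).asIdeal, t ≫ (act₀Of 𝓜 w I.univ I.act a xbar).hom.hom.hom = 1) →
      Module.finrank (geomResidueField w) (Alg G') = (I.pChar ^ I.fDeg * I.pChar ^ I.fDeg) * (I.pChar ^ I.fDeg * I.pChar ^ I.fDeg))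
    (quotΩ : ∀ y, LineOf I y → AlgPoints (S.M.obj Kc) (AlgebraicClosure (w.adicCompletion F)))
    (hdat : ∀ (y : AlgPoints (S.M.obj Kc) (AlgebraicClosure (w.adicCompletion F))) (L : LineOf I y),
      haveI := I.comm
      letI := (𝔡 (red₀Of S Kc 𝓜 w h𝓨 e y)).grp₀
      haveI := (𝔡 (red₀Of S Kc 𝓜 w h𝓨 e y)).aff₀
        ∃ (ψ : (sch₀Of 𝓜 w I.univ (red₀Of S Kc 𝓜 w h𝓨 e y)).X ⟶ (sch₀Of 𝓜 w (serreTensor I.act E' hE') (red₀Of S Kc 𝓜 w h𝓨 e (quotΩ y L))).X) (_ : IsMonHom ψ),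
          -- (FLAT-SURJ)
          (Flat ψ.left ∧ Function.Surjective ψ.left.base) ∧
          -- (ACT) `𝒪_F`-equivariance, `act₀Of` currency on both sides (`serreAction` on `𝒞`)
          (∀ a : 𝓞 F, (act₀Of 𝓜 w I.univ I.act a (red₀Of S Kc 𝓜 w h𝓨 e y)).hom.hom.hom ≫ ψ =
            ψ ≫ (act₀Of 𝓜 w (serreTensor I.act E' hE') (serreAction I.act E' hE') a (red₀Of S Kc 𝓜 w h𝓨 e (quotΩ y L))).hom.hom.hom) ∧
          -- (LVL) level points: `ψ(σᵃ(x̄)) = (σᵃ ≫ ψ_P)(x̄″)`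
          (∀ a : Fin I.g ⊕ Fin I.g → ZMod I.N,
            AlgPoints.map ψ (lvlPt₀Of 𝓜 w I.univ I.lvl (red₀Of S Kc 𝓜 w h𝓨 e y) a) =
              ((serreTensor I.act E' hE').baseChange (pullback.fst (𝓜.localise w).total.hom (specResidueField w))).restrictPt (red₀Of S Kc 𝓜 w h𝓨 e (quotΩ y L)).left
                ((serreTensor I.act E' hE').sectionBaseChange (pullback.fst (𝓜.localise w).total.hom (specResidueField w)) (I.lvl.section_ a ≫ serreTranslate I.act E' hE' P))) ∧
          -- (SIM) for EVERY downstairs dual pair of `𝒞_{x̄″}` through which the cover leg pulls back to `λ ≫ [p]`: `ψ^* λ_B̄ = λ_{x̄} ≫ [p]`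
          (∀ (DBs : (sch₀Of 𝓜 w (serreTensor I.act E' hE') (red₀Of S Kc 𝓜 w h𝓨 e (quotΩ y L))).DualPair)
            (_ : Nonempty ((Scheme.Modules.pullback (DualPair.unitHatSlice DBs)).obj DBs.P ≅ SheafOfModules.unit _))
            (lamBs : (sch₀Of 𝓜 w (serreTensor I.act E' hE') (red₀Of S Kc 𝓜 w h𝓨 e (quotΩ y L))).X ⟶ DBs.hat.X) [IsMonHom lamBs],
            (haveI := isMonHom_coverLeg (pullback.fst (𝓜.localise w).total.hom (specResidueField w)) (red₀Of S Kc 𝓜 w h𝓨 e (quotΩ y L)).left I.act E' hE' P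
             baseChangeHom (baseChangeHom (serreTranslate I.act E' hE' P) (pullback.fst (𝓜.localise w).total.hom (specResidueField w))) (red₀Of S Kc 𝓜 w h𝓨 e (quotΩ y L)).left ≫ lamBs ≫
                DualPair.dualIsogenyOver (baseChangeHom (baseChangeHom (serreTranslate I.act E' hE' P) (pullback.fst (𝓜.localise w).total.hom (specResidueField w))) (red₀Of S Kc 𝓜 w h𝓨 e (quotΩ y L)).left)
                  (dual₀Of 𝓜 w I.univ I.dual (red₀Of S Kc 𝓜 w h𝓨 e (quotΩ y L))) DBs =
              (pol₀Of 𝓜 w I.univ I.pol (red₀Of S Kc 𝓜 w h𝓨 e (quotΩ y L))).lam ≫ (dual₀Of 𝓜 w I.univ I.dual (red₀Of S Kc 𝓜 w h𝓨 e (quotΩ y L))).hat.mulN I.pChar) →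
            ψ ≫ lamBs ≫ DualPair.dualIsogenyOver ψ (dual₀Of 𝓜 w I.univ I.dual (red₀Of S Kc 𝓜 w h𝓨 e y)) DBs =
              (pol₀Of 𝓜 w I.univ I.pol (red₀Of S Kc 𝓜 w h𝓨 e y)).lam ≫ (dual₀Of 𝓜 w I.univ I.dual (red₀Of S Kc 𝓜 w h𝓨 e y)).hat.mulN I.pChar) ∧
          -- (K2-gen) every ideal bound on the kernel descends: `Ker q(Ω̄) ⊆ A_y[𝔞](Ω̄)` for the upstairs leg is recorded through `L`'s roof, so downstairs:
          (∀ 𝔞 : Ideal (𝓞 F), (∀ Pt ∈ L.1, IsIdealTorsionΩ S Kc 𝓜 w e I.univ I.act y 𝔞 Pt) →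
            (∀ Pt : (fibreΩOf S Kc 𝓜 w e I.univ y).Points (AlgebraicClosure (w.adicCompletion F)),
              (∀ r ∈ w.asIdeal * ((IsCMField.complexConj F) • w).asIdeal, (AlgPoints.map (actΩOf S Kc 𝓜 w e I.univ I.act r y).hom.hom.hom Pt :
                (fibreΩOf S Kc 𝓜 w e I.univ y).Points (AlgebraicClosure (w.adicCompletion F))) = 1) → IsIdealTorsionΩ S Kc 𝓜 w e I.univ I.act y 𝔞 Pt) →
            ∀ ⦃T : SchemeOver (geomResidueField w)⦄ (z : T ⟶ (sch₀Of 𝓜 w I.univ (red₀Of S Kc 𝓜 w h𝓨 e y)).X),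
              z ≫ ψ = 1 → ∀ r ∈ 𝔞, z ≫ (act₀Of 𝓜 w I.univ I.act r (red₀Of S Kc 𝓜 w h𝓨 e y)).hom.hom.hom = 1) ∧
          -- (RK) the rank of `Ker ψ`, BY VALUE for every closed realisation (LA2-p04 (g2) (C6′) `hrkᵢ` text)
          (∀ (K : SchemeOver (geomResidueField w)) [GrpObj K] [IsAffine K.left] [Module.Finite (geomResidueField w) (Alg K)]
            (κ : K ⟶ (sch₀Of 𝓜 w I.univ (red₀Of S Kc 𝓜 w h𝓨 e y)).X) [IsMonHom κ] [IsClosedImmersion κ.left],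
            (∀ ⦃T : SchemeOver (geomResidueField w)⦄ (t : T ⟶ (sch₀Of 𝓜 w I.univ (red₀Of S Kc 𝓜 w h𝓨 e y)).X), (∃ s : T ⟶ K, s ≫ κ = t) ↔ t ≫ ψ = 1) →
            Module.finrank (geomResidueField w) (Alg K) = I.pChar ^ I.fDeg * I.pChar ^ I.fDeg) ∧
          -- (KILL) `ψ` kills `V(spGeoOf y L) ↪ G₀(x̄) ↪ A_{x̄}`
          quotIncl (𝔡 (red₀Of S Kc 𝓜 w h𝓨 e y)).G₀ (spGeoOf I 𝔡 y L).1 ≫ (𝔡 (red₀Of S Kc 𝓜 w h𝓨 e y)).ι₀G ≫ ψ = 1 ∧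
          -- (DOCK) `Ker ψ ∩ G₀(x̄) = V(spGeoOf y L)` on all `T`-points of the dock
          ∀ ⦃T : SchemeOver (geomResidueField w)⦄ (t : T ⟶ (𝔡 (red₀Of S Kc 𝓜 w h𝓨 e y)).G₀),
            t ≫ (𝔡 (red₀Of S Kc 𝓜 w h𝓨 e y)).ι₀G ≫ ψ = 1 ↔
              ∃ s : T ⟶ specOver (geomResidueField w) (Alg (𝔡 (red₀Of S Kc 𝓜 w h𝓨 e y)).G₀ ⧸ (spGeoOf I 𝔡 y L).1),
                s ≫ quotIncl (𝔡 (red₀Of S Kc 𝓜 w h𝓨 e y)).G₀ (spGeoOf I 𝔡 y L).1 = t)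
    (hunr : ¬ (w.asIdeal ^ 2 ∣ Ideal.span {(I.pChar : 𝓞 F)}))
    (hpN : Nat.Coprime I.pChar I.N)
    (y y' : AlgPoints (S.M.obj Kc) (AlgebraicClosure (w.adicCompletion F))) (L : LineOf I y) (L' : LineOf I y')
    (h : red₀Of S Kc 𝓜 w h𝓨 e y = red₀Of S Kc 𝓜 w h𝓨 e y') (hsp : h ▸ spGeoOf I 𝔡 y L = spGeoOf I 𝔡 y' L') :
    red₀Of S Kc 𝓜 w h𝓨 e (quotΩ y L) = red₀Of S Kc 𝓜 w h𝓨 e (quotΩ y' L') := by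
  haveI := I.comm
  -- (1) TRANSPORT the `(y, L)`-datum to `x̄ := red₀ y′`, `H := spGeoOf I 𝔡 y′ L′` (C6α-T); read the `(y′, L′)`-datum as served
  obtain ⟨ψ₁, hm₁, hfs₁, ha₁, hl₁, hs₁, hk₁, hrk₁, -, hd₁⟩ := quotLegRows_at_of_eq I E' hE' P 𝔡 y L (quotΩ y L) (hdat y L) _ h _ hsp
  obtain ⟨ψ₂, hm₂, hfs₂, ha₂, hl₂, hs₂, hk₂, hrk₂, -, hd₂⟩ := hdat y' L'
  haveI := hm₁
  haveI := hm₂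
  -- (2) (K2-gen) at `𝔞 := 𝔭_w · 𝔭_{c•w}`: both kernels lie in `A_{x̄}[𝔭_w𝔭_{c•w}]`
  have hK₁ : ∀ ⦃T : SchemeOver (geomResidueField w)⦄ (z : T ⟶ (sch₀Of 𝓜 w I.univ (red₀Of S Kc 𝓜 w h𝓨 e y')).X),
      z ≫ ψ₁ = 1 → ∀ r ∈ w.asIdeal * ((IsCMField.complexConj F) • w).asIdeal, z ≫ (act₀Of 𝓜 w I.univ I.act r (red₀Of S Kc 𝓜 w h𝓨 e y')).hom.hom.hom = 1 :=
    hk₁ _ (fun Pt hPt a ha => L.2.2.1 Pt hPt a (Ideal.mul_le_left ha)) (fun Pt hPt => hPt)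
  have hK₂ : ∀ ⦃T : SchemeOver (geomResidueField w)⦄ (z : T ⟶ (sch₀Of 𝓜 w I.univ (red₀Of S Kc 𝓜 w h𝓨 e y')).X),
      z ≫ ψ₂ = 1 → ∀ r ∈ w.asIdeal * ((IsCMField.complexConj F) • w).asIdeal, z ≫ (act₀Of 𝓜 w I.univ I.act r (red₀Of S Kc 𝓜 w h𝓨 e y')).hom.hom.hom = 1 :=
    hk₂ _ (fun Pt hPt a ha => L'.2.2.1 Pt hPt a (Ideal.mul_le_left ha)) (fun Pt hPt => hPt)
  -- `hunr′` derived (LA2-p03 (g2) by copy)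
  have hunr' : ¬ (((IsCMField.complexConj F) • w).asIdeal ^ 2 ∣ Ideal.span {((I.pChar : ℕ) : 𝓞 F)}) :=
    not_sq_conj_dvd_span_of_not_sq_dvd_span w I.pChar hunr
  -- (3) the exact-twist pairs at the two targets (W1) and the (SIM) ∀-rows instantiated at them (the SAME objects feed both sockets)
  obtain ⟨DB₁, hDB₁, lamB₁, hmon₁, hex₁⟩ := exists_roofMiddleDual₀ I E' hE' P Q hP hQ hQP hPQ h𝔭 (red₀Of S Kc 𝓜 w h𝓨 e (quotΩ y L))
  obtain ⟨DB₂, hDB₂, lamB₂, hmon₂, hex₂⟩ := exists_roofMiddleDual₀ I E' hE' P Q hP hQ hQP hPQ h𝔭 (red₀Of S Kc 𝓜 w h𝓨 e (quotΩ y' L'))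
  haveI := hmon₁
  haveI := hmon₂
  have hsim₁ := hs₁ DB₁ hDB₁ lamB₁ hex₁
  have hsim₂ := hs₂ DB₂ hDB₂ lamB₂ hex₂
  -- (4) (C6′) «equal dock parts ⇒ equal kernels» (LA2-p04 (g2) socket)
  have hker : ∀ ⦃T : SchemeOver (geomResidueField w)⦄ (t : T ⟶ (sch₀Of 𝓜 w I.univ (red₀Of S Kc 𝓜 w h𝓨 e y')).X), t ≫ ψ₁ = 1 ↔ t ≫ ψ₂ = 1 :=
    fun T t => comp_eq_one_iff_of_two_quotLegs I E' hE' hunr hunr' 𝔡 (red₀Of S Kc 𝓜 w h𝓨 e y') (spGeoOf I 𝔡 y' L') (hrkG _)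
      (red₀Of S Kc 𝓜 w h𝓨 e (quotΩ y L)) (red₀Of S Kc 𝓜 w h𝓨 e (quotΩ y' L')) ψ₁ ψ₂
      DB₁ hDB₁ lamB₁ hsim₁ DB₂ hDB₂ lamB₂ hsim₂ ha₁ ha₂ hK₁ hK₂ hd₁ hd₂ hrk₁ hrk₂ t
  -- (5) (C3𝒞) the common-source engine with `𝒞`-targets (LA2-p01 (g2) socket)
  exact red₀Of_eq_of_common_source_serre I E' hE' P Q hP hQ hQP hPQ 𝔠 hQ𝔠 h𝔠 (red₀Of S Kc 𝓜 w h𝓨 e y') (quotΩ y L) (quotΩ y' L') ψ₁ ψ₂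
    hfs₁ hfs₂ ha₁ ha₂ hl₁ hl₂ hker DB₁ hDB₁ lamB₁ hex₁ hsim₁ DB₂ hDB₂ lamB₂ hex₂ hsim₂ hpN

end QuotWDFold

end Block_Q

end Summit.HodgeConjecture.HodgeConjecture.Cruxes.HLiu418.F0P6aLineSpecialisation

end
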